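import Mathlib
import HarnessLib
import HarnessLib.Audit
import Summits.MatrixMultiplication.Statement
import Literature.Computability.AlgebraicComplexity.AsymptoticSpectrum
import Literature.Computability.AlgebraicComplexity.FlatteningBound
import HarnessLib.Audit.Status.Attr

/-!
Route: IrreducibleSublevelSets

DORMANT since 2026-08-23T22:05:38Z (reconciler: no traction for 6.3 d (last activity item-evidence-added at 2026-08-17T14:43:13Z); parked, not closed — `ledger route dormant route-MatrixMultiplication-IrreducibleSublevelSets --off` to r) — unstaffed, not closed; items shared with open routes are served there. `ledger route dormant <id> --off` reactivates.

# Route IrreducibleSublevelSets — CHNVZ's printed question — irreducible sublevel sets of asymptotic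
rank force omega = 2 by counting values

It suffices to show X = SublevelIrreducible, the question
Christandl–Hoeberechts–Nieuwboer–Vrana–Zuiddam print and leave
open (arXiv:2411.15789 = ChristandlHoeberechtsNieuwboerVranaZuiddam2025, §5 p. 14: "it is natural to
ask about the geometric
properties of these sets. For instance, we may ask if they are irreducible … For k ≥ 3,
irreduciblity is open. It would imply …
a weak form of Strassen's asymptotic rank conjecture: there exist at most d₁⋯d_k asymptotic ranks in
format d₁ × ⋯ × d_k"):
for every format a × b × c over ℂ and every level r ≥ 0 the (Zariski-closed, their Thm 1.2, PROVED
in tree as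
chnvz_zariskiClosed_asymptoticRank_le_holds) sublevel set {T : R~(T) ≤ r} has a PRIME vanishing
ideal in ℂ[x_ijk].
The deciding theorem `closes : SublevelIrreducible → IrreducibleFewBridge → ManyAsymptoticRanks →
MatrixMultiplication` is
proved (folder glue.lean / Sketch.lean, rc 0): the printed dimension argument (bridge, support)
turns X into "≤ abc+1 asymptotic
ranks per format", and the NEW link ManyAsymptoticRanks says that ω(ℂ) > 2 would manufacture more
than N³+1 of them in N×N×N.
Lean: `∀ (a b c : ℕ) (r : ℝ), 0 ≤ r → (MvPolynomial.vanishingIdeal ℂ {x : Fin a × Fin b × Fin c → ℂ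
| Literature.Computability.AlgebraicComplexity.asymptoticRank (fun (i : Fin a) (j : Fin b) (k : Fin
c) => x (i, j, k)) ≤ r}).IsPrime`

## Assembly
Pure logic, PROVED sorry-free as the deciding theorem `closes (h₁ : SublevelIrreducible) (h₂ :
IrreducibleFewBridge)
(h₃ : ManyAsymptoticRanks) : MatrixMultiplication` (glue.lean; Sketch.lean assembly_provable, lean
check rc 0): rewrite the summit as
ω(ℂ) = 2 (MatrixMultiplication_iff); 2 ≤ ω is the tree's omega_two_le; if ω ≠ 2 then 2 < ω, h₃ gives
N with more than N·N·N + 1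
asymptotic ranks in format N × N × N, h₂ h₁ N N N gives at most N·N·N + 1 — contradiction.

Rationale: WHY THIS LINE. Mechanism (new, not in the paper): COUNT the values of R~ in one format. If 2 < ω(ℂ)
(< 2.41, tree BCS1997_cor1543) the
padded direct sums D = ⊕_j c_j⟨n_j,n_j,n_j⟩ ⊕ ⟨m⟩ fit in format N×N×N whenever Σ c_j n_j² + m ≤ N
and have R~(D) = Σ c_j n_j^ω + m
EXACTLY — "≤" by subadditivity and R~(⟨q,q,q⟩) = q^ω (tree asymptoticRank_matMulTensor), "≥" by
Schönhage's asymptotic sum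
inequality applied to every Kronecker power (Schonhage1981; tree sum_rpow_omega_le_asymptoticRank,
matMulDirectSum); with
{1, n₁^ω, n₂^ω, n₃^ω} ℚ-linearly independent — such n_j exist because dim_ℚ span{n^ω : n ≥ 1} = ∞
for non-integer ω (six
exponentials theorem, Lang1966 / Waldschmidt2000 §1.4, for irrational ω: else 2^ω, 3^ω, 5^ω all
algebraic; radical degrees
[ℚ(2^{1/b},3^{1/b}):ℚ] = b² ≥ 9 for ω = a/b, b ≥ 3) — the values are pairwise distinct and number ≥
N⁴/(256 n₁²n₂²n₃²) > N³+1,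
contradicting the printed consequence of X (chain of prime vanishing ideals in ℂ[x_1..x_{N³}] has
length ≤ Krull dimension N³,
Mathlib MvPolynomial.ringKrullDim_of_isNoetherianRing). Imported areas: commutative algebra /
Zariski geometry of the CHNVZ
sublevel varieties (the crux), Strassen's asymptotic spectrum (ASI exactness of cube sums,
Strassen1988,
AlmanDuanVassilevskaWilliamsXuXuZhou2025 Thm 3.1), transcendence theory (six exponentials; the tree
already proves Roy's strong
form roy1992_strongSixExponentials_holds). What no prior route does: all 65 open
MatrixMultiplication routes EVALUATE or BOUND
R~ / border rank of specific tensors or host designs; none uses the arithmetic of the VALUE SET of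
R~ per format; the only card in
that direction (asymptotic-rank-integrality-numerology, closed declined:vacuous) asked for
integrality AT ⟨2,2,2⟩, which restates
ω = 2 — here the hypothesis is a qualitative geometric property of all sublevel sets that never
mentions matrix multiplication.

RANKED CRUXES. #2 SublevelIrreducible (crux) — CHNVZ §5 printed open question (k = 3, over ℂ): for
every format a × b × c and every r ≥ 0 the sublevel set {T ∈ ℂ^{a×b×c} : R~(T) ≤ r} is irreducible,
i.e. its vanishing ideal in MvPolynomial (Fin a × Fin b × Fin c) ℂ is prime (r ≥ 0 makes the set
non-empty: it contains 0; closedness is CHNVZ Thm 1.2, proved in tree). [difficulty: open-problem]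
(why it might fail: arXiv:2411.15789 p.14: open for k ≥ 3; via this route it forces every asymptotic
rank to be algebraic of degree ≤ 3, so ONE tensor with R~ transcendental or of degree ≥ 4 (e.g. a
non-integer R~(cw_2) ∈ (3, 3.93)) makes some Z_r reducible.)
[ChristandlHoeberechtsNieuwboerVranaZuiddam2025, arXiv:2411.15789, arXiv:2404.06427, Strassen1988]
#3 ManyAsymptoticRanks (crux) — the new link: if 2 < ω(ℂ) then some cubic format N × N × N over ℂ
realises more than N³ + 1 distinct asymptotic ranks (witnesses: zero-padded direct sums ⊕_j
c_j⟨n_j,n_j,n_j⟩ ⊕ ⟨m⟩, Σ_j c_j n_j² + m ≤ N, with R~ = Σ_j c_j n_j^ω + m by the asymptotic sum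
inequality + subadditivity, and {1, n₁^ω, n₂^ω, n₃^ω} ℚ-independent by the six exponentials theorem
since 2 < ω < 2.41 is not an integer). [difficulty: L] (why it might fail: needs EXACT values:
R~(⊕cubes ⊕ units) ≤ Σ n^ω + m wants subadditivity of the infimum-defined asymptoticRank over Σ-type
blocks + padding invariance; distinctness wants dim_ℚ span{n^ω} ≥ 4 — six exponentials (ω ∉ ℚ) or
radical degrees (ω = a/b, b ≥ 3); a slip collapses the count to O(N³).) [Schonhage1981,
Strassen1988, AlmanDuanVassilevskaWilliamsXuXuZhou2025, Lang1966, Waldschmidt2000,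
lean:Literature.Computability.AlgebraicComplexity.sum_rpow_omega_le_asymptoticRank,
lean:Literature.Barriers.Schanuel.roy1992_strongSixExponentials_holds]
#9 FewAsymptoticRanks (support) — CHNVZ's printed weak form of the asymptotic rank conjecture (§5 p.
14, consequence of SublevelIrreducible): every format a × b × c over ℂ realises at most abc + 1
distinct asymptotic ranks (the value 0 of the zero tensor included; the refuters' handle — a single
tensor with R~ of algebraic degree ≥ 4 or transcendental refutes it, by the powers-of-one-tensor
count). [difficulty: open-problem] [ChristandlHoeberechtsNieuwboerVranaZuiddam2025,
arXiv:2411.15789]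
#9 IrreducibleFewBridge (support) — the printed implication (CHNVZ §5: "This follows from a
dimension argument (topological dimension is maximal length of a decreasing chain of irreducible
subvarieties, and the dimension of 𝔽^{d₁×⋯×d_k} is d₁⋯d_k)"): SublevelIrreducible →
FewAsymptoticRanks. Provable now: values v₀ < … < v_k realised in a format give, by CHNVZ Thm 1.2
(tree theorem chnvz_zariskiClosed_asymptoticRank_le_holds: Z_r = zeroLocus (vanishingIdeal Z_r)), a
strictly decreasing chain of k+1 prime ideals of ℂ[x_1..x_{abc}], so k ≤ ringKrullDim = abc (Mathlib
MvPolynomial.ringKrullDim_of_isNoetherianRing). [difficulty: provable-now]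
[ChristandlHoeberechtsNieuwboerVranaZuiddam2025,
lean:Literature.Computability.AlgebraicComplexity.chnvz_zariskiClosed_asymptoticRank_le_holds]

TWO-LAYER PLAN. Foreseen glued splits (nothing filed now; the birth skeletons bc/*_birth.lean carry
them as stubs): ManyAsymptoticRanks ⇐
SpanFour (∀ s, 2 < s < 2.41 → ∃ n₁ n₂ n₃ ≥ 2 with (1, n₁^s, n₂^s, n₃^s) ℚ-linearly independent; six
exponentials + radicals) →
CubeSumValues (∃ T in format N with R~(T) = Σ c_j n_j^ω + m whenever Σ c_j n_j² + m ≤ N; ASI +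
subadditivity + padding) →
LatticeCount (#{(c,m) : Σ c_j n_j² + m ≤ N} > N³+1 for large N) → ManyAsymptoticRanks (composition =
injectivity from linear
independence + encard monotonicity, PROVED in bc/ManyAsymptoticRanks_birth.lean).
SublevelIrreducible ⇐ DominantParametrisation
(Z_r is the Zariski closure of the image of an affine space under a polynomial map — under ARC the
map (A,B,C,core) ↦ Σ A⊗B⊗C·core)
→ PrimeOfImage (the vanishing ideal of a polynomial image of 𝔸ⁿ is prime) → SublevelIrreducible
(PROVED composition in
bc/SublevelIrreducible_birth.lean). FewAsymptoticRanks may replace SublevelIrreducible + bridge in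
`closes` if proved directly.

KILL CRITERIA. A tensor T over ℂ with R~(T) provably NOT algebraic of degree ≤ 3 (or any format with
≥ abc+2 distinct asymptotic ranks) refutes
FewAsymptoticRanks, hence (CHNVZ Thm 1.2 being a theorem) SublevelIrreducible: close
refuted:SublevelIrreducible and record the
reducible sublevel set under Literature/Barriers (it is also a theorem of independent interest: a
non-integer asymptotic rank).
A reducible Z_r exhibited directly in a small format (pencils 2 × b × c via Kronecker normal forms,
or 3×3×3 via Nurmiev's
classification) refutes SublevelIrreducible as typed but leaves the cubic-format count alive: pivot
`closes` to FewAsymptoticRanks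
restricted to cubic formats (new item) if the witness is non-cubic. ManyAsymptoticRanks refuted
would mean the six-exponentials /
ASI bookkeeping is mis-typed (repair as misstated); it cannot be substantively false unless the
tree's asymptoticRank deviates from
the printed R~. ω(ℂ) = 2 proved on any other route moots the route; ω(ℂ) > 2 (route
BorderRankLowerBound) turns `closes` into a
proof that some sublevel set is reducible.

NOT DECOMPOSED YET. The three children of ManyAsymptoticRanks (SpanFour, CubeSumValues,
LatticeCount) and the two of SublevelIrreducible
(DominantParametrisation, PrimeOfImage) are stubs of the birth skeletons, not items (D-0019: depth
is earned after a crux is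
claimed). The classical six exponentials theorem in ℚ-form is NOT yet a tree declaration (the tree
proves Roy's strong ℚ̄-form
roy1992_strongSixExponentials_holds and holds Baker as the named fact
Literature.NumberTheory.Transcendental.baker; the ℚ-form
follows from strong-six-exponentials + Baker + Gelfond–Schneider, or is vendored from Lang1966 Ch.
II §1 / Waldschmidt2000 §1.4) —
a cite item for the prover of ManyAsymptoticRanks, deliberately not filed as a route item. No format
other than cubic N×N×N is
needed by `closes`; SublevelIrreducible is nevertheless filed for all formats, as printed.

CHEAPEST FALSIFIER. (1) Lookup (run this session): is any asymptotic rank KNOWN to be a non-integer?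
No — every computed R~ equals a flattening rank
(Wigderson–Zuiddam survey; CHNVZ §1 "consistent with the asymptotic rank conjecture"); smallest
unknown: R~(cw_2) ∈ [3, 3.931)
(arXiv:2605.21738 Thm 1.3). (2) Format 2×2×2 (run by hand): values {0, 1, 2}; Z_0 = {0}, Z_1 = Segre
cone, Z_2 = ℂ^8 — all
irreducible, 3 ≤ 9 values: consistent. (3) The refuter's first real test: pencil formats 2 × b × c,
where Kronecker normal forms
make R~ computable if R~ = border rank there; decide whether {T ∈ ℂ^{2×2×3} : R~(T) ≤ 2} is
irreducible. (4) Prove or break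
ManyAsymptoticRanks' value formula on the smallest instance: R~(⟨2,2,2⟩ ⊕ ⟨1⟩) = 2^ω + 1 (tree:
asymptoticRank_multiple_matMulTensor
gives the multiple case t·q^ω already).

NUMBERS. 2 ≤ ω(ℂ) < 2.41 in tree (omega_two_le, BCS1997_cor1543); record ω < 2.371339
(AlmanDuanVassilevskaWilliamsXuXuZhou2025). Count
used by ManyAsymptoticRanks: #{(c₁,c₂,c₃,m) ∈ ℕ⁴ : Σ c_j n_j² + m ≤ N} ≥ N⁴/(256 n₁² n₂² n₃²) > N³ +
1 once N > 256 n₁²n₂²n₃² + 1;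
chain bound: ≤ abc + 1 values per format (Krull dimension abc). Known value sets: format 2×2×2 →
{0,1,2}; a×b×1 → {0,…,min(a,b)}.
R~(cw_2) < 3.931 (arXiv:2605.21738). Items at open: 5 (2 cruxes, 2 supports, 1 assembly).

DEFINITION REQUESTS. None: asymptoticRank, matMulDirectSum, directSumTensor, kroneckerPow,
unitTensor (Literature.Computability.AlgebraicComplexity),
MvPolynomial.vanishingIdeal, ringKrullDim (Mathlib) all exist. Cite fact wanted later by the prover
of ManyAsymptoticRanks: the
classical six exponentials theorem (Lang1966 Ch. II Thm 1; Waldschmidt2000 §1.4) in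
ℚ-linear-independence form.

Novelty: Searches (2026-08-17): payload corpus frontier.json (60 rows since 2023) + reads.jsonl (6 papers
grepped for open-question
phrases) + `lit read` at page level of arXiv:2605.21738, 2404.06427, 2204.03826, 2601.08119,
2411.15789 (this question: p. 14);
`lit citing arxiv:2411.15789` (3 local citers: BAMS survey doi:10.1090/bull/1880, arXiv:2604.18283,
BUMI survey 2025 — none on
irreducibility; API citers rate-limited 429); `lit galaxy search "support functionals coincide with
the quantum functionals"
--star all` (0); grep of all 73 Theses + 43 open / closed Ideas for irreducib|well-ordered|Krull|six
exponentials|transcend|sublevel|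
"distinct asymptotic ranks" (hits only: closed card asymptotic-rank-integrality-numerology —
integrality AT ⟨2,2,2⟩, declined as
restating S; HesseHammingShells/HessianPlane use CHNVZ semicontinuity, not irreducibility); `ledger
negatives` (7, all design
statements); lean search for asymptoticRank / vanishingIdeal / ringKrullDim / SixExponential (tree
has CHNVZ Thm 1.2 PROVED, ASI for
R~ PROVED, Roy's strong six exponentials PROVED).
Nearest prior art found: ChristandlHoeberechtsNieuwboerVranaZuiddam2025 §5 (the question and its
weak-ARC consequence, stopping at
"at most d₁⋯d_k asymptotic ranks"; authors' words: "For k ≥ 3, irreduciblity is open");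
arXiv:2404.06427 (Kaski–Michałek:
universal sequences, no value counting); closed card asymptotic-rank-integrality-numerology (six
exponentials used only for
"n^ω algebraic for n = 2,3,5 ⇒ ω ∈ ℚ").
Delta: t  [refs: 10.1090/bull/1880, 2605.21738, 2411.15789, 2604.18283, 2404.06427, arxiv:2411.15789, doi:10.1090/bull/1880]

Barriers (technique_class: value-counting, asymptotic-rank-geometry, transcendence): - technique_class: value-counting, asymptotic-rank-geometry, transcendence
- Literature.Barriers.MatrixMultiplication.UniversalMethodBarrier: not in class — no upper bound on
ω is extracted from (degenerations of powers of) a fixed intermediate tensor; the bound comes from a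
global geometric property of all sublevel sets plus a count.
- Literature.Barriers.MatrixMultiplication.IrreversibilityBarrier: same — no intermediate tensor, no
asymptotic restriction chain; irreversibility of CW_q / cw_q is irrelevant to the chain-of-primes
argument.
- Literature.Barriers.MatrixMultiplication.UnstableTensorBarrier: same — the witnesses ⊕ c_j⟨n_j⟩ ⊕
⟨m⟩ are only used for their EXACT asymptotic ranks (ASI), never as starting tensors of a method.
- Literature.Barriers.MatrixMultiplication.InfimumNotMinimumBarrier: respected — no single
(border-)rank bound certifies an exponent; the contradiction is asymptotic in N (values are
asymptotic ranks, the count exceeds N³+1 only for large N).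
- Literature.Barriers.MatrixMultiplication.LinearRankMethodBarrier: not in class (no lower bound on
any border rank is claimed; refutation-side barrier).
- Negatives index: 7 refuted statements (TPP/STPP design families in S_n, Z_m, F_q; separable
designs) — none concerns asymptotic-rank values or sublevel sets; nothing re-asked.

History (route lifecycle, newest last):
- 2026-08-23T22:05:38Z · DORMANT — reconciler: no traction for 6.3 d (last activity item-evidence-added at 2026-08-17T14:43:13Z); parked, not closed — `ledger route dormant route-MatrixMultiplica (operator:999:1479721)

sub-problem: MatrixMultiplication · status: dormant · opened planner-plan-lens3-MatrixMultiplication-oqh-g2-0 2026-08-17T03:14:16Z · rev 1 · ledger route-MatrixMultiplication-IrreducibleSublevelSets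
GENERATED by the gate from the ledger (D-0016/17). Provers cite these decls: `theorem foo : Summit.MatrixMultiplication.MatrixMultiplication.Theses.IrreducibleSublevelSets.<Decl> := …` in Summits/MatrixMultiplication/MatrixMultiplication/Theorems/<Name>.lean.
-/

namespace Summit.MatrixMultiplication.MatrixMultiplication.Theses.IrreducibleSublevelSets

open scoped BigOperators Topology Manifold Classical MeasureTheory ProbabilityTheory Matrix InnerProductSpace ComplexConjugate ContinuousMap
open Filter Set Function TopologicalSpace MeasureTheory

attribute [summit_statement] _root_.MatrixMultiplication

/-- item stmt-MatrixMultiplication-19017 · crux · rank 2 · open · by planner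
why it might fail: arXiv:2411.15789 p.14: open for k ≥ 3; via this route it forces every asymptotic rank to be algebraic of degree ≤ 3, so ONE tensor with R~ transcendental or of degree ≥ 4 (e.g. a non-integer R~(cw_2) ∈ (3, 3.93)) makes some Z_r reducible.
sources: ChristandlHoeberechtsNieuwboerVranaZuiddam2025, arXiv:2411.15789, arXiv:2404.06427, Strassen1988
[crux] CHNVZ §5 printed open question (k = 3, over ℂ): for every format a × b × c and every r ≥ 0
the sublevel set {T ∈ ℂ^{a×b×c} : R~(T) ≤ r} is irreducible, i.e. its vanishing ideal in
MvPolynomial (Fin a × Fin b × Fin c) ℂ is prime (r ≥ 0 makes the set non-empty: it contains 0;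
closedness is CHNVZ Thm 1.2, proved in tree). [difficulty: open-problem] -/
@[route_item "route-MatrixMultiplication-IrreducibleSublevelSets", crux]
def SublevelIrreducible : Prop :=
  ∀ (a b c : ℕ) (r : ℝ), 0 ≤ r → (MvPolynomial.vanishingIdeal ℂ {x : Fin a × Fin b × Fin c → ℂ | Literature.Computability.AlgebraicComplexity.asymptoticRank (fun (i : Fin a) (j : Fin b) (k : Fin c) => x (i, j, k)) ≤ r}).IsPrime

/-- item stmt-MatrixMultiplication-19018 · crux · rank 3 · open · by planner
why it might fail: needs EXACT values: R~(⊕cubes ⊕ units) ≤ Σ n^ω + m wants subadditivity of the infimum-defined asymptoticRank over Σ-type blocks + padding invariance; distinctness wants dim_ℚ span{n^ω} ≥ 4 — six exponentials (ω ∉ ℚ) or radical degrees (ω = a/b, b ≥ 3); a slip collapses the count to O(N³).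
sources: Schonhage1981, Strassen1988, AlmanDuanVassilevskaWilliamsXuXuZhou2025, Lang1966, Waldschmidt2000, lean:Literature.Computability.AlgebraicComplexity.sum_rpow_omega_le_asymptoticRank
[crux] the new link: if 2 < ω(ℂ) then some cubic format N × N × N over ℂ realises more than N³ + 1
distinct asymptotic ranks (witnesses: zero-padded direct sums ⊕_j c_j⟨n_j,n_j,n_j⟩ ⊕ ⟨m⟩, Σ_j c_j
n_j² + m ≤ N, with R~ = Σ_j c_j n_j^ω + m by the asymptotic sum inequality + subadditivity, and {1,
n₁^ω, n₂^ω, n₃^ω} ℚ-independent by the six exponentials theorem since 2 < ω < 2.41 is not an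
integer). [difficulty: L] -/
@[route_item "route-MatrixMultiplication-IrreducibleSublevelSets", crux]
def ManyAsymptoticRanks : Prop :=
  2 < Literature.Computability.AlgebraicComplexity.omega ℂ → ∃ N : ℕ, ((N * N * N + 1 : ℕ) : ℕ∞) < (Set.range fun T : Fin N → Fin N → Fin N → ℂ => Literature.Computability.AlgebraicComplexity.asymptoticRank T).encard

/-- item stmt-MatrixMultiplication-19019 · crux (kind.auto-crux: conjecture-grade) · rank 9 · open · by planner
why it might fail: auto-crux — conjecture-grade statement (docstring avows it ('conjecture')); it is open, so it may simply be false
sources: ChristandlHoeberechtsNieuwboerVranaZuiddam2025, arXiv:2411.15789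
[support] CHNVZ's printed weak form of the asymptotic rank conjecture (§5 p. 14, consequence of
SublevelIrreducible): every format a × b × c over ℂ realises at most abc + 1 distinct asymptotic
ranks (the value 0 of the zero tensor included; the refuters' handle — a single tensor with R~ of
algebraic degree ≥ 4 or transcendental refutes it, by the powers-of-one-tensor count). [difficulty:
open-problem] -/
@[route_item "route-MatrixMultiplication-IrreducibleSublevelSets"]
def FewAsymptoticRanks : Prop :=
  ∀ a b c : ℕ, (Set.range fun T : Fin a → Fin b → Fin c → ℂ => Literature.Computability.AlgebraicComplexity.asymptoticRank T).encard ≤ (a * b * c + 1 : ℕ)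

/-- item stmt-MatrixMultiplication-19020 · support · rank 9 · open · by planner
sources: ChristandlHoeberechtsNieuwboerVranaZuiddam2025, lean:Literature.Computability.AlgebraicComplexity.chnvz_zariskiClosed_asymptoticRank_le_holds
[support] the printed implication (CHNVZ §5: "This follows from a dimension argument (topological
dimension is maximal length of a decreasing chain of irreducible subvarieties, and the dimension of
𝔽^{d₁×⋯×d_k} is d₁⋯d_k)"): SublevelIrreducible → FewAsymptoticRanks. Provable now: values v₀ < … <
v_k realised in a format give, by CHNVZ Thm 1.2 (tree theorem
chnvz_zariskiClosed_asymptoticRank_le_holds: Z_r = zeroLocus (vanishingIdeal Z_r)), a strictly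
decreasing chain of k+1 prime ideals of ℂ[x_1..x_{abc}], so k ≤ ringKrullDim = abc (Mathlib
MvPolynomial.ringKrullDim_of_isNoetherianRing). [difficulty: provable-now] -/
@[route_item "route-MatrixMultiplication-IrreducibleSublevelSets", crux]
def IrreducibleFewBridge : Prop :=
  SublevelIrreducible → FewAsymptoticRanks

/-- item stmt-MatrixMultiplication-19021 · assembly · rank 1 · open · by planner
sources: ChristandlHoeberechtsNieuwboerVranaZuiddam2025, Schonhage1981
[assembly] SublevelIrreducible → IrreducibleFewBridge → ManyAsymptoticRanks → MatrixMultiplication. -/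
@[route_item "route-MatrixMultiplication-IrreducibleSublevelSets"]
def Assembly : Prop :=
  SublevelIrreducible → IrreducibleFewBridge → ManyAsymptoticRanks → MatrixMultiplication

/-! D-0027 §2.1 — DECIDING THEOREM (planner-authored via `route open/edit --closes-file`; by planner-plan-lens3-MatrixMultiplication-oqh-g2-0 2026-08-17T03:14:16Z):
its hypotheses are this route's items and its conclusion the sub-problem Statement (glue_lint), and it elaborates with this file. -/

/-- Deciding theorem (D-0027 §2.1).  Pure logic over tree facts: `ω(ℂ) ≥ 2` (`omega_two_le`); if
`ω(ℂ) ≠ 2` then `2 < ω(ℂ)`, so `ManyAsymptoticRanks` yields a cubic format `N × N × N` with more than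
`N³ + 1` asymptotic ranks, while `IrreducibleFewBridge` applied to `SublevelIrreducible` bounds their
number by `N·N·N + 1` — contradiction. -/
@[closes "route-MatrixMultiplication-IrreducibleSublevelSets"] theorem closes (h₁ : SublevelIrreducible) (h₂ : IrreducibleFewBridge) (h₃ : ManyAsymptoticRanks) :
    MatrixMultiplication := by
  rw [_root_.MatrixMultiplication_iff]
  by_contra hne
  have hω2 : (2 : ℝ) ≤ Literature.Computability.AlgebraicComplexity.omega ℂ :=
    Literature.Computability.AlgebraicComplexity.omega_two_le ℂ
  have hlt : 2 < Literature.Computability.AlgebraicComplexity.omega ℂ :=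
    lt_of_le_of_ne hω2 (Ne.symm hne)
  obtain ⟨N, hN⟩ := h₃ hlt
  exact absurd (lt_of_lt_of_le hN (h₂ h₁ N N N)) (lt_irrefl _)

end Summit.MatrixMultiplication.MatrixMultiplication.Theses.IrreducibleSublevelSets
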